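import Summits.CriticalPhenomena.PercolationContinuityZ3.Theorems.PercNearOneGluingAdditiveGluingPairStepOneRelay

/-!
# `PercNearOneGluing` · crux `AdditiveGluing` (stmt-CriticalPhenomena-4576) · line `peel` · strategy (a): RELAY INSERTION

Support file (`--supports stmt-CriticalPhenomena-4576`); no definitions, no named facts.

Strategy (a) of the peel cell reads the pair step `stub_pairGamma` (`K(s)·Z(S) ≤ K(S)·Z(s)`, `S = {s, x}`) as an induction on
the RELAY set: the base case `A = {b, a₀}` is the landed one-relay rung (`pairStep_oneRelay`, hypothesis-free), and the step
inserts one relay `a₁ ∉ A`.  Everything in the pair step that depends on the relay set is the dead-pocket mass with worst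
selection `Z_A(X) = Σ_{W ∩ A = ∅} μ(K_X = W) · min_{a ∈ A} μ(a ↔ b in Wᶜ)`; the deficits `D(s) = μ(a₀↔b) − μ(s↔b)` and
`D(S) = μ(a₀↔b) + μ(a₀↮b, a₀↔S, S↔b) − μ(S↔b)` do not see `A`.  Inserting `a₁` removes the pockets through `a₁` (the
LIVE-FAIL mass `LF_A(X) = Σ_{W ∩ A = ∅, a₁ ∈ W} μ(K_X = W)·min_A`) and lowers the selection on the remaining ones (the RE-ORDERING
loss `RO_A(X) = Σ_{W ∩ (A ∪ a₁) = ∅} μ(K_X = W)·(min_A − min_{A ∪ a₁}) ≥ 0`):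

* `relayInsert_sum_eq` (bookkeeping): `Z_{A ∪ a₁}(X) = Z_A(X) − LF_A(X) − RO_A(X)` for any pocket masses and selections;
* `relayInsert_sum_le`: `Z_{A ∪ a₁}(X) ≤ Z_A(X)` (the worst-selection pocket mass is antitone in the relay set);
* `relayInsert_pairStep_iff` (the relay-insertion step of the pair step, exact): with the margin
  `M_A := D(s)·Z_A(S) − D(S)·Z_A(s)`, the pair step at `A ∪ a₁` holds IFF the CROSS TERM is paid by the margin at `A`:
  `D(s)·(LF_A(S) + RO_A(S)) − D(S)·(LF_A(s) + RO_A(s)) ≤ M_A`  — i.e. `M_{A ∪ a₁} = M_A − X^{LF} − X^{RO}`.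
  At `A = {b, a₀}` the margin `M_A = WIN(S)·LOSE(s) − WIN(s)·LOSE(S) ≥ 0` is `pairStep_oneRelay`; the live-fail cross term
  `X^{LF}` is the part that needs the minimiser hypothesis (numerically it exceeds `M_A` in 23 % of non-minimal designations and
  never at the minimiser; `sup X/M_A = 1` on the tie family `s ⊣ a₀, x ⊣ a₁, μ(a₁↔b) = μ(a₀↔b)`), so no proper part of `M_A`
  can be spent before the exchange: the step is the whole two-relay pair step (evidence `PEEL-A-RelayInsertion.md` in the crux dir).
[cite: KozmaNitzan2024, §3.2 Definition p. 12, Thms 4–5 pp. 12–14, Question 7 p. 36]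
-/

namespace Summit.CriticalPhenomena.PercolationContinuityZ3.Theorems

open MeasureTheory Set
open Literature.Probability.LatticeModels (prodBernoulli)
open Literature.Probability.Percolation (BondConfig openConn openConnIn openGraph openCluster)

noncomputable section
open Classical
open scoped BigOperators

variable {n : ℕ}

/-- **Relay insertion, bookkeeping.**  For pocket masses `c W`, an "old" selection value `g W` and a "new" one `g' W`, and
admissibility predicates `R` (old) and `R'` (new) with `R' W ↔ R W ∧ a₁ ∉ W`:
`Σ_{R'} c·g' = Σ_{R} c·g − Σ_{R ∧ a₁ ∈ W} c·g − Σ_{R'} c·(g − g')`. [folklore] -/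
theorem relayInsert_sum_eq (R R' : Finset (Fin n) → Prop) {_iR : DecidablePred R} {_iR' : DecidablePred R'} (a₁ : Fin n)
    (hRR' : ∀ W, R' W ↔ (R W ∧ a₁ ∉ W)) (c g g' : Finset (Fin n) → ℝ) :
    ∑ W ∈ (Finset.univ : Finset (Finset (Fin n))).filter R', c W * g' W =
      ∑ W ∈ (Finset.univ : Finset (Finset (Fin n))).filter R, c W * g W
        - ∑ W ∈ (Finset.univ : Finset (Finset (Fin n))).filter (fun W => R W ∧ a₁ ∈ W), c W * g W
        - ∑ W ∈ (Finset.univ : Finset (Finset (Fin n))).filter R', c W * (g W - g' W) := by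
  have hsplit := Finset.sum_filter_add_sum_filter_not ((Finset.univ : Finset (Finset (Fin n))).filter R)
    (fun W => a₁ ∈ W) (fun W => c W * g W)
  rw [Finset.filter_filter, Finset.filter_filter] at hsplit
  have hR' : (Finset.univ : Finset (Finset (Fin n))).filter (fun W => R W ∧ ¬ a₁ ∈ W) =
      (Finset.univ : Finset (Finset (Fin n))).filter R' := by
    refine Finset.filter_congr fun W _ => ?_
    rw [hRR' W]
  rw [hR'] at hsplit
  have hsub : ∑ W ∈ (Finset.univ : Finset (Finset (Fin n))).filter R', c W * (g W - g' W) =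
      ∑ W ∈ (Finset.univ : Finset (Finset (Fin n))).filter R', c W * g W
        - ∑ W ∈ (Finset.univ : Finset (Finset (Fin n))).filter R', c W * g' W := by
    rw [← Finset.sum_sub_distrib]
    refine Finset.sum_congr rfl fun W _ => ?_
    ring
  rw [hsub]
  linarith

/-- **Relay insertion lowers the pocket mass**: with nonnegative masses, a nonnegative old selection value and a new one
below it on the new pockets, `Σ_{R'} c·g' ≤ Σ_{R} c·g`. [folklore] -/
theorem relayInsert_sum_le (R R' : Finset (Fin n) → Prop) {_iR : DecidablePred R} {_iR' : DecidablePred R'} (a₁ : Fin n)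
    (hRR' : ∀ W, R' W ↔ (R W ∧ a₁ ∉ W)) (c g g' : Finset (Fin n) → ℝ)
    (hc : ∀ W, 0 ≤ c W) (hg : ∀ W, 0 ≤ g W) (hgg' : ∀ W, R' W → g' W ≤ g W) :
    ∑ W ∈ (Finset.univ : Finset (Finset (Fin n))).filter R', c W * g' W ≤
      ∑ W ∈ (Finset.univ : Finset (Finset (Fin n))).filter R, c W * g W := by
  rw [relayInsert_sum_eq R R' a₁ hRR' c g g']
  have h1 : 0 ≤ ∑ W ∈ (Finset.univ : Finset (Finset (Fin n))).filter (fun W => R W ∧ a₁ ∈ W), c W * g W :=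
    Finset.sum_nonneg fun W _ => mul_nonneg (hc W) (hg W)
  have h2 : 0 ≤ ∑ W ∈ (Finset.univ : Finset (Finset (Fin n))).filter R', c W * (g W - g' W) :=
    Finset.sum_nonneg fun W hW => mul_nonneg (hc W) (sub_nonneg.2 (hgg' W (Finset.mem_filter.1 hW).2))
  linarith

/-- The admissible pockets after inserting the relay `a₁`: `W ∩ (A ∪ a₁) = ∅ ↔ W ∩ A = ∅ ∧ a₁ ∉ W` (block form). [folklore] -/
theorem relayInsert_disjoint_iff (W A : Finset (Fin n)) (a₁ : Fin n) :
    Disjoint W (insert a₁ A) ↔ (Disjoint W A ∧ a₁ ∉ W) := by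
  rw [Finset.disjoint_insert_right, and_comm]

/-- The admissible pockets after inserting the relay `a₁` (point form, `s ∈ W`). [folklore] -/
theorem relayInsert_mem_disjoint_iff (W A : Finset (Fin n)) (s a₁ : Fin n) :
    (s ∈ W ∧ Disjoint W (insert a₁ A)) ↔ ((s ∈ W ∧ Disjoint W A) ∧ a₁ ∉ W) := by
  rw [relayInsert_disjoint_iff, and_assoc]

/-- The worst selection over `A ∪ a₁` is below the worst selection over `A`. [folklore] -/
theorem relayInsert_inf'_le (A : Finset (Fin n)) (b a₁ : Fin n) (hb : b ∈ A) (f : Fin n → ℝ) :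
    (insert a₁ A).inf' ⟨b, Finset.mem_insert_of_mem hb⟩ f ≤ A.inf' ⟨b, hb⟩ f :=
  Finset.inf'_mono f (Finset.subset_insert a₁ A) _

/-- **The relay-insertion step of the pair step (exact).**  For reals standing for the quantities of `stub_pairGamma` —
reliabilities `τs = μ(s↔b)`, `τS = μ(S↔b)`, `τa = μ(a₀↔b)`, hijack `H = μ(a₀↮b, a₀↔S, S↔b)`, pocket masses `Zp, Zb` at the
relay set `A`, and the live-fail / re-ordering losses `LFp, ROp` (point) and `LFb, ROb` (block) of inserting `a₁` — the pair
step at `A ∪ a₁`, `(τs + Zp' − τa)·Zb' ≤ (τS + Zb' − τa − H)·Zp'` with `Z' = Z − LF − RO`, holds iff the cross term is paid by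
the margin at `A`: `(τa − τs)(LFb + ROb) − (τa + H − τS)(LFp + ROp) ≤ (τa − τs)·Zb − (τa + H − τS)·Zp`. [folklore] -/
theorem relayInsert_pairStep_iff (τs τS τa H Zp Zb LFp LFb ROp ROb : ℝ) :
    ((τs + (Zp - LFp - ROp) - τa) * (Zb - LFb - ROb) ≤ (τS + (Zb - LFb - ROb) - τa - H) * (Zp - LFp - ROp)) ↔
      ((τa - τs) * (LFb + ROb) - (τa + H - τS) * (LFp + ROp) ≤ (τa - τs) * Zb - (τa + H - τS) * Zp) := by
  constructor <;> intro h <;> nlinarith [h]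

/-- The worst-selection value of a pocket is nonnegative. [folklore] -/
theorem relayInsert_inf'_nonneg (w : Sym2 (Fin n) → unitInterval) (A : Finset (Fin n)) (b : Fin n) (hA : A.Nonempty)
    (W : Finset (Fin n)) :
    0 ≤ A.inf' hA (fun a => (prodBernoulli w).real (openConnIn ((W : Set (Fin n))ᶜ) a b)) :=
  (Finset.le_inf'_iff hA _).2 fun _ _ => measureReal_nonneg

/-- **The dead-pocket mass of the point is antitone in the relay set**:
`Z_{A ∪ a₁}(s) ≤ Z_A(s)` (worst selection, pockets `W ∋ s` avoiding the relays). [folklore; cf. KozmaNitzan2024 §3.2 p. 12] -/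
theorem relayInsert_pointPockets_le (w : Sym2 (Fin n) → unitInterval) (A : Finset (Fin n)) (b a₁ s : Fin n)
    (hb : b ∈ A) :
    ∑ W ∈ (Finset.univ : Finset (Finset (Fin n))).filter (fun W => s ∈ W ∧ Disjoint W (insert a₁ A)),
        (prodBernoulli w).real {ω : BondConfig (Fin n) | openCluster ω s = (W : Set (Fin n))}
          * (insert a₁ A).inf' ⟨b, Finset.mem_insert_of_mem hb⟩ (fun a =>
              (prodBernoulli w).real (openConnIn ((W : Set (Fin n))ᶜ) a b)) ≤
      ∑ W ∈ (Finset.univ : Finset (Finset (Fin n))).filter (fun W => s ∈ W ∧ Disjoint W A),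
        (prodBernoulli w).real {ω : BondConfig (Fin n) | openCluster ω s = (W : Set (Fin n))}
          * A.inf' ⟨b, hb⟩ (fun a => (prodBernoulli w).real (openConnIn ((W : Set (Fin n))ᶜ) a b)) :=
  relayInsert_sum_le (fun W : Finset (Fin n) => s ∈ W ∧ Disjoint W A)
    (fun W : Finset (Fin n) => s ∈ W ∧ Disjoint W (insert a₁ A)) (_iR := inferInstance) (_iR' := inferInstance) a₁
    (fun W => relayInsert_mem_disjoint_iff W A s a₁) _ _ _ (fun _ => measureReal_nonneg)
    (fun W => relayInsert_inf'_nonneg w A b ⟨b, hb⟩ W) (fun _ _ => relayInsert_inf'_le A b a₁ hb _)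

/-- **The dead-pocket mass of a block is antitone in the relay set**: `Z_{A ∪ a₁}(S) ≤ Z_A(S)`; hence block goodness
`K_A(S) = μ(S↔b) + Z_A(S) − μ_{u/S}(a₀↔b)` is antitone in `A` (more relays, harder goodness). [folklore; cf. KozmaNitzan2024 §3.2 p. 12] -/
theorem relayInsert_blockPockets_le (w : Sym2 (Fin n) → unitInterval) (A S : Finset (Fin n)) (b a₁ : Fin n)
    (hb : b ∈ A) :
    ∑ W ∈ (Finset.univ : Finset (Finset (Fin n))).filter (fun W => Disjoint W (insert a₁ A)),
        (prodBernoulli w).real {ω : BondConfig (Fin n) | ∀ z : Fin n, (z ∈ W ↔ ω ∈ ⋃ v ∈ S, openConn v z)}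
          * (insert a₁ A).inf' ⟨b, Finset.mem_insert_of_mem hb⟩ (fun a =>
              (prodBernoulli w).real (openConnIn ((W : Set (Fin n))ᶜ) a b)) ≤
      ∑ W ∈ (Finset.univ : Finset (Finset (Fin n))).filter (fun W => Disjoint W A),
        (prodBernoulli w).real {ω : BondConfig (Fin n) | ∀ z : Fin n, (z ∈ W ↔ ω ∈ ⋃ v ∈ S, openConn v z)}
          * A.inf' ⟨b, hb⟩ (fun a => (prodBernoulli w).real (openConnIn ((W : Set (Fin n))ᶜ) a b)) :=
  relayInsert_sum_le (fun W : Finset (Fin n) => Disjoint W A)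
    (fun W : Finset (Fin n) => Disjoint W (insert a₁ A)) (_iR := inferInstance) (_iR' := inferInstance) a₁
    (fun W => relayInsert_disjoint_iff W A a₁) _ _ _ (fun _ => measureReal_nonneg)
    (fun W => relayInsert_inf'_nonneg w A b ⟨b, hb⟩ W) (fun _ _ => relayInsert_inf'_le A b a₁ hb _)

/-- **STUB `stub_pairGammaRelayInsert_a` (strategy (a) of the peel cell: the relay-insertion step of `stub_pairGamma`, exact).**
For any weighting `w` (in `stub_pairGamma`: the glued weighting `u/T`), relays `A ∋ b`, a new relay `a₁ ∉ A`, the observer `s`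
and the bystander `x`: the conclusion of `stub_pairGamma` at the relay set `insert a₁ A` holds IFF the CROSS TERM of inserting
`a₁` — `D(s)·(LF(S) + RO(S)) − D(S)·(LF(s) + RO(s))`, live-fail pockets through `a₁` plus re-ordering losses to `a₁` — is at
most the margin `D(s)·Z_A(S) − D(S)·Z_A(s)` at the relay set `A` (`D(s) = μ(a₀↔b) − μ(s↔b)`,
`D(S) = μ(a₀↔b) + μ(a₀↮b, a₀↔S, S↔b) − μ(S↔b)`, `S = {s, x}`).  At `A = {b, a₀}` the margin is the landed one-relay rung
(`pairStep_oneRelay`); the cross-term inequality there is the whole two-relay pair step (no hypothesis is consumed by the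
equivalence). [cite: KozmaNitzan2024, §3.2 Definition p. 12, Thms 4–5 pp. 12–14, Question 7 p. 36] -/
theorem stub_pairGammaRelayInsert_a :
    ∀ (n : ℕ) (w : Sym2 (Fin n) → unitInterval) (A : Finset (Fin n)) (b a₀ a₁ x s : Fin n) (hb : b ∈ A), a₁ ∉ A →
      (((prodBernoulli w).real (openConn s b)
          + (∑ W ∈ Finset.univ.filter (fun W => s ∈ W ∧ Disjoint W (insert a₁ A)),
              (prodBernoulli w).real {ω | openCluster ω s = (W : Set (Fin n))}
                * (insert a₁ A).inf' ⟨b, Finset.mem_insert_of_mem hb⟩ (fun a =>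
                    (prodBernoulli w).real (openConnIn ((W : Set (Fin n))ᶜ) a b)))
          - (prodBernoulli w).real (openConn a₀ b))
        * (∑ W ∈ Finset.univ.filter (fun W => Disjoint W (insert a₁ A)),
              (prodBernoulli w).real
                  {ω | ∀ z : Fin n, (z ∈ W ↔ ω ∈ ⋃ v ∈ ({s, x} : Finset (Fin n)), openConn v z)}
                * (insert a₁ A).inf' ⟨b, Finset.mem_insert_of_mem hb⟩ (fun a =>
                    (prodBernoulli w).real (openConnIn ((W : Set (Fin n))ᶜ) a b)))
      ≤ ((prodBernoulli w).real (⋃ v ∈ ({s, x} : Finset (Fin n)), openConn v b)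
          + (∑ W ∈ Finset.univ.filter (fun W => Disjoint W (insert a₁ A)),
              (prodBernoulli w).real
                  {ω | ∀ z : Fin n, (z ∈ W ↔ ω ∈ ⋃ v ∈ ({s, x} : Finset (Fin n)), openConn v z)}
                * (insert a₁ A).inf' ⟨b, Finset.mem_insert_of_mem hb⟩ (fun a =>
                    (prodBernoulli w).real (openConnIn ((W : Set (Fin n))ᶜ) a b)))
          - (prodBernoulli w).real (openConn a₀ b)
          - (prodBernoulli w).real
              ((openConn a₀ b)ᶜ ∩ (⋃ v ∈ ({s, x} : Finset (Fin n)), openConn a₀ v)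
                ∩ (⋃ v ∈ ({s, x} : Finset (Fin n)), openConn v b)))
        * (∑ W ∈ Finset.univ.filter (fun W => s ∈ W ∧ Disjoint W (insert a₁ A)),
              (prodBernoulli w).real {ω | openCluster ω s = (W : Set (Fin n))}
                * (insert a₁ A).inf' ⟨b, Finset.mem_insert_of_mem hb⟩ (fun a =>
                    (prodBernoulli w).real (openConnIn ((W : Set (Fin n))ᶜ) a b)))
      ↔
      ((prodBernoulli w).real (openConn a₀ b) - (prodBernoulli w).real (openConn s b))
          * ((∑ W ∈ Finset.univ.filter (fun W => Disjoint W A ∧ a₁ ∈ W),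
                (prodBernoulli w).real
                    {ω | ∀ z : Fin n, (z ∈ W ↔ ω ∈ ⋃ v ∈ ({s, x} : Finset (Fin n)), openConn v z)}
                  * A.inf' ⟨b, hb⟩ (fun a => (prodBernoulli w).real (openConnIn ((W : Set (Fin n))ᶜ) a b)))
            + (∑ W ∈ Finset.univ.filter (fun W => Disjoint W (insert a₁ A)),
                (prodBernoulli w).real
                    {ω | ∀ z : Fin n, (z ∈ W ↔ ω ∈ ⋃ v ∈ ({s, x} : Finset (Fin n)), openConn v z)}
                  * (A.inf' ⟨b, hb⟩ (fun a => (prodBernoulli w).real (openConnIn ((W : Set (Fin n))ᶜ) a b))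
                      - (insert a₁ A).inf' ⟨b, Finset.mem_insert_of_mem hb⟩ (fun a =>
                          (prodBernoulli w).real (openConnIn ((W : Set (Fin n))ᶜ) a b)))))
        - ((prodBernoulli w).real (openConn a₀ b)
            + (prodBernoulli w).real
                ((openConn a₀ b)ᶜ ∩ (⋃ v ∈ ({s, x} : Finset (Fin n)), openConn a₀ v)
                  ∩ (⋃ v ∈ ({s, x} : Finset (Fin n)), openConn v b))
            - (prodBernoulli w).real (⋃ v ∈ ({s, x} : Finset (Fin n)), openConn v b))
          * ((∑ W ∈ Finset.univ.filter (fun W => (s ∈ W ∧ Disjoint W A) ∧ a₁ ∈ W),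
                (prodBernoulli w).real {ω | openCluster ω s = (W : Set (Fin n))}
                  * A.inf' ⟨b, hb⟩ (fun a => (prodBernoulli w).real (openConnIn ((W : Set (Fin n))ᶜ) a b)))
            + (∑ W ∈ Finset.univ.filter (fun W => s ∈ W ∧ Disjoint W (insert a₁ A)),
                (prodBernoulli w).real {ω | openCluster ω s = (W : Set (Fin n))}
                  * (A.inf' ⟨b, hb⟩ (fun a => (prodBernoulli w).real (openConnIn ((W : Set (Fin n))ᶜ) a b))
                      - (insert a₁ A).inf' ⟨b, Finset.mem_insert_of_mem hb⟩ (fun a =>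
                          (prodBernoulli w).real (openConnIn ((W : Set (Fin n))ᶜ) a b)))))
        ≤ ((prodBernoulli w).real (openConn a₀ b) - (prodBernoulli w).real (openConn s b))
            * (∑ W ∈ Finset.univ.filter (fun W => Disjoint W A),
                (prodBernoulli w).real
                    {ω | ∀ z : Fin n, (z ∈ W ↔ ω ∈ ⋃ v ∈ ({s, x} : Finset (Fin n)), openConn v z)}
                  * A.inf' ⟨b, hb⟩ (fun a => (prodBernoulli w).real (openConnIn ((W : Set (Fin n))ᶜ) a b)))
          - ((prodBernoulli w).real (openConn a₀ b)
              + (prodBernoulli w).real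
                  ((openConn a₀ b)ᶜ ∩ (⋃ v ∈ ({s, x} : Finset (Fin n)), openConn a₀ v)
                    ∩ (⋃ v ∈ ({s, x} : Finset (Fin n)), openConn v b))
              - (prodBernoulli w).real (⋃ v ∈ ({s, x} : Finset (Fin n)), openConn v b))
            * (∑ W ∈ Finset.univ.filter (fun W => s ∈ W ∧ Disjoint W A),
                (prodBernoulli w).real {ω | openCluster ω s = (W : Set (Fin n))}
                  * A.inf' ⟨b, hb⟩ (fun a => (prodBernoulli w).real (openConnIn ((W : Set (Fin n))ᶜ) a b)))) := by
  intro n w A b a₀ a₁ x s hb ha₁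
  -- the point sums and the block sums at `insert a₁ A`, rewritten through the relay set `A`
  have hp := relayInsert_sum_eq (fun W : Finset (Fin n) => s ∈ W ∧ Disjoint W A)
    (fun W : Finset (Fin n) => s ∈ W ∧ Disjoint W (insert a₁ A)) (_iR := inferInstance) (_iR' := inferInstance) a₁
    (fun W => relayInsert_mem_disjoint_iff W A s a₁)
    (fun W => (prodBernoulli w).real {ω : BondConfig (Fin n) | openCluster ω s = (W : Set (Fin n))})
    (fun W => A.inf' ⟨b, hb⟩ (fun a => (prodBernoulli w).real (openConnIn ((W : Set (Fin n))ᶜ) a b)))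
    (fun W => (insert a₁ A).inf' ⟨b, Finset.mem_insert_of_mem hb⟩ (fun a =>
      (prodBernoulli w).real (openConnIn ((W : Set (Fin n))ᶜ) a b)))
  have hk := relayInsert_sum_eq (fun W : Finset (Fin n) => Disjoint W A)
    (fun W : Finset (Fin n) => Disjoint W (insert a₁ A)) (_iR := inferInstance) (_iR' := inferInstance) a₁
    (fun W => relayInsert_disjoint_iff W A a₁)
    (fun W => (prodBernoulli w).real
      {ω : BondConfig (Fin n) | ∀ z : Fin n, (z ∈ W ↔ ω ∈ ⋃ v ∈ ({s, x} : Finset (Fin n)), openConn v z)})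
    (fun W => A.inf' ⟨b, hb⟩ (fun a => (prodBernoulli w).real (openConnIn ((W : Set (Fin n))ᶜ) a b)))
    (fun W => (insert a₁ A).inf' ⟨b, Finset.mem_insert_of_mem hb⟩ (fun a =>
      (prodBernoulli w).real (openConnIn ((W : Set (Fin n))ᶜ) a b)))
  rw [hp, hk]
  exact relayInsert_pairStep_iff _ _ _ _ _ _ _ _ _ _

end

end Summit.CriticalPhenomena.PercolationContinuityZ3.Theorems
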